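import Mathlib
import Summits.AnomalousDissipation.AnomalousDissipation.Theorems.SoloBlindMonodromyTaylor

/-!
# Solo-blind: a uniform resolvent bound passes to norm limits without loss
  (abstract half of the J-TAIL `N → ∞` passage; paper §24.91(4) (MB-J), STATE-OF-PROOF row J-TAIL)

Theorem (MB-J) certifies, for every FINITE truncation `N ≥ J` of the leaf chain, that `1 − M_N(P)` is
invertible with `‖(1 − M_N(P))⁻¹‖ ≤ K` uniformly in `N`.  The operator that (P⁺)_F needs is the monodromy
`M = M_∞(P)` of the infinite chain.  The passage is two facts: (i) `‖M − M̃_N‖ → 0` for the zero-padded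
truncations — the parabolic-damping estimate, chain-specific, still owed as typed; and (ii) the abstract
statement proved here, in any complete normed ring with `‖1‖ = 1` (bounded operators on a Banach space):

* (used) kernel #153's `one_sub_inverse_of_near`: `‖(1 − M₀)⁻¹‖ ≤ C`, `‖M − M₀‖ ≤ η`, `η C < 1`
  ⇒ `1 − M` invertible, `‖(1 − M)⁻¹‖ ≤ C/(1 − η C)`;
* `one_sub_inverse_of_limit` — if `M` is approximated ARBITRARILY WELL in norm by operators `M₀` with
  `1 − M₀` invertible and `‖(1 − M₀)⁻¹‖ ≤ C` (the same `C`), then `1 − M` is invertible and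
  `‖(1 − M)⁻¹‖ ≤ C` — the uniform bound survives the limit with NO loss (not `C/(1 − θ)`).
-/

namespace Summit.AnomalousDissipation.AnomalousDissipation.Theorems

variable {A : Type*} [NormedRing A] [NormOneClass A] [CompleteSpace A]

/-- **No-loss limit passage.**  If for every `ε > 0` there is `M₀` with `‖M − M₀‖ ≤ ε`, `1 − M₀`
invertible and `‖(1 − M₀)⁻¹‖ ≤ C`, then `1 − M` is invertible and `‖(1 − M)⁻¹‖ ≤ C`. -/
theorem one_sub_inverse_of_limit {M : A} {C : ℝ} (hC : 0 ≤ C)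
    (h : ∀ ε > 0, ∃ M₀ : A, IsUnit (1 - M₀) ∧ ‖Ring.inverse (1 - M₀)‖ ≤ C ∧ ‖M - M₀‖ ≤ ε) :
    IsUnit (1 - M) ∧ ‖Ring.inverse (1 - M)‖ ≤ C := by
  have hε₀ : (0 : ℝ) < 1 / (2 * C + 1) := by positivity
  have hCε₀ : (1 / (2 * C + 1)) * C < 1 := by
    rw [one_div_mul_eq_div, div_lt_one (by positivity)]; linarith
  -- invertibility from one good approximation
  obtain ⟨M₀, hu₀, hC₀, hδ₀⟩ := h _ hε₀
  have hunit : IsUnit (1 - M) := (one_sub_inverse_of_near hu₀ hC₀ hδ₀ hCε₀).1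
  refine ⟨hunit, ?_⟩
  -- the bound: for every η > 0, ‖(1 − M)⁻¹‖ ≤ C + η
  refine le_of_forall_pos_le_add fun η hη => ?_
  set ε : ℝ := min (1 / (2 * C + 1)) (η / (2 * C ^ 2 + 1)) with hεdef
  have hεpos : 0 < ε := lt_min hε₀ (by positivity)
  have hε1 : ε ≤ 1 / (2 * C + 1) := min_le_left _ _
  have hε2 : ε ≤ η / (2 * C ^ 2 + 1) := min_le_right _ _
  obtain ⟨M₁, hu₁, hC₁, hδ₁⟩ := h ε hεpos
  have hCε : ε * C < 1 := lt_of_le_of_lt (mul_le_mul_of_nonneg_right hε1 hC) hCε₀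
  have hbound : ‖Ring.inverse (1 - M)‖ ≤ C / (1 - ε * C) :=
    (one_sub_inverse_of_near hu₁ hC₁ hδ₁ hCε).2
  -- from ‖R‖ ≤ C/(1 − Cε): ‖R‖(1 − Cε) ≤ C, 1 − Cε ≥ 1/2, so ‖R‖ ≤ 2C and ‖R‖ ≤ C + 2C²ε ≤ C + η
  have h1Cε : 0 < 1 - ε * C := by linarith
  have hmul : ‖Ring.inverse (1 - M)‖ * (1 - ε * C) ≤ C := (le_div_iff₀ h1Cε).1 hbound
  have hhalf : 1 / 2 ≤ 1 - ε * C := by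
    have h2 : (1 / (2 * C + 1)) * C ≤ 1 / 2 := by
      rw [one_div_mul_eq_div, div_le_iff₀ (by positivity)]; linarith
    have := mul_le_mul_of_nonneg_right hε1 hC
    linarith
  have hR2C : ‖Ring.inverse (1 - M)‖ ≤ 2 * C := by nlinarith [norm_nonneg (Ring.inverse (1 - M))]
  have hCεη : 2 * C ^ 2 * ε ≤ η := by
    have := (le_div_iff₀ (by positivity : (0:ℝ) < 2 * C ^ 2 + 1)).1 hε2
    nlinarith [hεpos.le]
  nlinarith [norm_nonneg (Ring.inverse (1 - M)), mul_nonneg hC hεpos.le]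

end Summit.AnomalousDissipation.AnomalousDissipation.Theorems
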